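import Summits.BirchSwinnertonDyer.BirchSwinnertonDyer.Theorems.RamifiedHeegnerPairRamifiedPairUpperBoundInsideRoute
import Summits.BirchSwinnertonDyer.BirchSwinnertonDyer.Theorems.KatoDescentPotSupersingularWildUpperHeegnerTwist
import Summits.BirchSwinnertonDyer.Rank1Residual.Additive.TypeGRamification
import Summits.BirchSwinnertonDyer.Rank1Residual.O5.GssSplitThree
import Literature.NumberTheory.EllipticCurves.CastellaGrossiLeeSkinner2022.RankOneTwistIdentity
import Literature.NumberTheory.EllipticCurves.QuadraticTwistJInvariantProofs
import HarnessLib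

/-!
# Route `RamifiedHeegnerPair`, crux X2 `RamifiedPairUpperBound` (stmt-BirchSwinnertonDyer-23192) — the W-ALL leaf
# Gss2 at `3` is STABLE under Heegner twisting: the twist of a non-CM `(G) ∧ ss` curve by the discriminant of an
# imaginary quadratic field in which every prime of `N_E` splits is again a non-CM `(G) ∧ ss` curve

HONEST FRAMING. Theorems only; helper file (`--supports stmt-BirchSwinnertonDyer-23192 --as helper`); nothing is
booked, no item is closed, BSD is not proved for any curve. This is the bookkeeping the skeleton-v4 roads for the
leaf stubs `stub_leafRankOneUpper` / `stub_leafRankZeroUpper` use silently: the rank-one (resp. rank-zero)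
member's Euler-system half over a SPLIT Heegner field `K′` consumes the LOWER half of the twist `W^{(d_{K′})}`
of complementary rank, and inside the route that lower half is available exactly for LEAF members
(`RamifiedPairUpperBound.leafMissingLowerBoundAt_of_pairLower_of_supply_of_residual`, p607794, whose X2 theorem
took `¬ HasCM Wd`, `Addv Wd 3`, `SubGss Wd 3` as undischarged hypotheses `hCMd haddd hsubd`). Here they are
discharged:

* `leaf_twist_of_heegner` — for `W/ℚ` globally minimal, non-CM, additive of census cell `(G) ∧ ss` at `3`
  (`Addv W 3 ∧ SubGss W 3`: `e = 2`, Kodaira `I₀*`, `E = V₀ ⊗ χ₋₃` with `V₀` good supersingular at `3`), an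
  imaginary quadratic `K` of ODD discriminant with the Heegner hypothesis for `N_E` (so `3 ∣ N_E` splits:
  `d_K ∈ ℚ₃^{×2}`, `3 ∤ d_K`, `d_K ≡ 1 (mod 4)`), and ANY globally minimal model `Wd = Cd • E^{(d_K)}`:
  `¬ HasCM Wd ∧ Addv Wd 3 ∧ SubGss Wd 3 ∧ j(Wd) = j(E)`.
* `jointUpperBoundAt_rankOne_inside_route_of_socket` — p607794's `jointUpperBoundAt_rankOne_of_socket_inside_route`
  with the three leaf hypotheses on the twist DISCHARGED (and `d_{K′} < −4` derived): INSIDE the route (binders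
  `hP hT hSR hR` of `closes` + X1 `hL`) X2's conclusion at a rank-ONE pair `(W, V, d)` costs exactly the printed facts
  and ONE split Heegner datum of `W` with odd `d_{K′}`, `L(W^{(d_{K′})},1) ≠ 0` and the Kolyvagin-side socket
  `SchneiderFree.Upper.IndexUpperBoundLeAt W 3 K′ P (v₃ c)` — nothing else.

Mechanism (all tree lemmas; the (t′)-cell twin is k8t-c4's `subTprime_twist_of_heegner`): `Addv`, `j`, `f₃` and
`ord₃ Δ` transport along a `3`-adic-square twist unramified at `3` (`AdditivePotMult.addv_iff_of_twist`,
`AdditivePotMult.j_of_model_twist`, k9-c4's `conductorExponent_eq_of_model_twist_of_not_dvd`,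
`padicValRat_u_eq_zero_of_twist_minimal_of_dvd`), which gives `SubGord Wd 3`; the supersingular half of the cell
is read through the census dictionary `O5.subGss_three_iff_subGord_and_goodSS_twist` (`SubGss ⟺ SubGord ∧` the
minimal model of the `χ₋₃`-twist is GOOD SUPERSINGULAR at `3`): the `χ₋₃`-twist `Vd` of `Wd` is a `ℚ`-model of
`V^{(d_K)}` for the `χ₋₃`-twist `V` of `W` (`quadraticTwist_smul`, `quadraticTwist_quadraticTwist`), so it is good
at `3` (`AdditivePotMult.good_iff_of_twist`, `d_K` a `3`-adic square) with `a₃(Vd) = a₃(V)` (`3` split in `K`: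
Knapp Prop. 12.10, tree `CastellaGrossiLeeSkinner2022.frobeniusTrace_eq_of_split_twist`).

References: [cite: SilvermanATAEC1994, IV.9.4 (PDF pp. 344–346)] [cite: Knapp1993, Prop. 12.10]
[cite: Delbourgo1998, §1.5 (G)] [cite: Serre1973, Ch. II §3.3 Thm. 3]. Lead prover bsd-line-rhp-p2 g3, 2026-08-28.
-/

-- D-0017: single-problem summit, so `Summit.BirchSwinnertonDyer.BirchSwinnertonDyer.…` repeats a namespace BY DESIGN.
set_option linter.dupNamespace false
set_option autoImplicit false

noncomputable section

open scoped Classical NumberField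

open WeierstrassCurve IsDedekindDomain IsDedekindDomain.HeightOneSpectrum NumberField
  Rat.HeightOneSpectrum Literature.NumberTheory.EllipticCurves
  Literature.NumberTheory.EllipticCurves.ModularForms
  Literature.NumberTheory.EllipticCurves.Rank1Residual
  Literature.NumberTheory.EllipticCurves.Rank1Residual.Typed
  Literature.NumberTheory.QuadraticFields
  Summit.BirchSwinnertonDyer.Rank1Residual
  Summit.BirchSwinnertonDyer.Rank1Residual.Additive
  Summit.BirchSwinnertonDyer.BirchSwinnertonDyer.Theses.RamifiedHeegnerPair
  Summit.BirchSwinnertonDyer.BirchSwinnertonDyer.Theorems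
  Summit.BirchSwinnertonDyer.BirchSwinnertonDyer.Theorems.SchneiderFree

namespace Summit.BirchSwinnertonDyer.BirchSwinnertonDyer.Theorems.RamifiedPairUpperBound

/-- **Delbourgo's cell `(G)` at `3` is stable under Heegner twisting** (the `SubGord` half): for `W` globally
minimal, additive at `3` with `SubGord W 3` (`ord₃ j ≥ 0`, `f₃ = 2`, `e ∣ 2`), `K` imaginary quadratic of ODD
discriminant with the Heegner hypothesis for `N_E`, and a globally minimal `Wd = Cd • E^{(d_K)}`:
`Addv Wd 3 ∧ SubGord Wd 3 ∧ j(Wd) = j(E)`. Word for word k8t-c4's `subTprime_twist_of_heegner` with `e ∤ p − 1`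
replaced by `e ∣ p − 1`. [folklore] [cite: SilvermanATAEC1994, IV.9.4 (PDF pp. 344–346)] -/
theorem subGord_twist_of_heegner (W : WeierstrassCurve ℚ) [W.IsElliptic] [W.IsGloballyMinimal]
    (hadd : Addv W 3) (hG : SubGord W 3)
    (K : Type) [Field K] [NumberField K] (hK : IsImaginaryQuadratic K)
    (hHN : SatisfiesHeegnerHypothesis (W.conductorNorm ℤ) K) (hodd : Odd (NumberField.discr K))
    (Wd : WeierstrassCurve ℚ) [Wd.IsElliptic] [Wd.IsGloballyMinimal] (Cd : VariableChange ℚ)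
    (hWd : Cd • W.quadraticTwist (NumberField.discr K : ℚ) = Wd) :
    Addv Wd 3 ∧ SubGord Wd 3 ∧ Wd.j = W.j := by
  have hp : (3 : ℕ).Prime := Fact.out
  have hD0 : (NumberField.discr K : ℚ) ≠ 0 := by exact_mod_cast NumberField.discr_ne_zero K
  have hpN : 3 ∣ W.conductorNorm ℤ :=
    (W.dvd_conductorNorm_iff_not_hasGoodReductionAtPrime 3).mpr (not_good_of_addv W 3 hadd)
  have hsq' : IsSquare (algebraMap ℚ ℚ_[3] (NumberField.discr K : ℚ)) :=
    X11b.isSquare_discr_padic_of_heegner K hK hHN 3 hpN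
  have hsq : IsSquare (((NumberField.discr K : ℚ) : ℚ) : ℚ_[3]) := by simpa using hsq'
  have hj : Wd.j = W.j := AdditivePotMult.j_of_model_twist (W := W) hD0 ⟨Cd, hWd⟩
  have haddv : Addv Wd 3 := (AdditivePotMult.addv_iff_of_twist (W := W) hD0 hsq Wd hWd).mpr hadd
  -- `3 ∤ d_K` (split primes are unramified) and `d_K ≡ 1 (mod 4)` (odd discriminant)
  have hpd : ¬ ((3 : ℕ) : ℤ) ∣ NumberField.discr K :=
    Literature.SatisfiesHeegnerHypothesis.not_dvd_discr hK.1 hHN hp hpN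
  have hd4 : NumberField.discr K % 4 = 1 := Quadratic.discr_emod_four_eq_one hK.1 hodd
  -- the conductor exponent at `3` is unchanged
  have hf : condExp Wd 3 = condExp W 3 := by
    unfold condExp
    refine conductorExponent_eq_of_model_twist_of_not_dvd W Wd hd4 Cd hWd (placeOf 3) ?_
    rw [natGenerator_placeOf_eq]
    exact hpd
  -- the discriminant valuation at `3` is unchanged
  have hu : padicValRat 3 (Cd.u : ℚ) = 0 :=
    AdditivePotMult.padicValRat_u_eq_zero_of_twist_minimal_of_dvd W 3 K hK hHN hpN Cd hWd
  have hΔ : padicValRat 3 Wd.Δ = padicValRat 3 W.Δ := by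
    haveI := W.isElliptic_quadraticTwist hD0
    have hu0 : ((Cd.u⁻¹ : ℚˣ) : ℚ) ≠ 0 := (Cd.u⁻¹).ne_zero
    have hΔ0 : W.Δ ≠ 0 := W.isUnit_Δ.ne_zero
    have hd6 : (NumberField.discr K : ℚ) ^ 6 ≠ 0 := pow_ne_zero 6 hD0
    have hdv : padicValRat 3 (NumberField.discr K : ℚ) = 0 := by
      rw [padicValRat.of_int, padicValInt.eq_zero_of_not_dvd hpd, Nat.cast_zero]
    have huv : padicValRat 3 ((Cd.u⁻¹ : ℚˣ) : ℚ) = 0 := by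
      rw [Units.val_inv_eq_inv_val, padicValRat.inv, hu, neg_zero]
    rw [← hWd, variableChange_Δ, quadraticTwist_Δ, padicValRat.mul (pow_ne_zero 12 hu0)
      (mul_ne_zero hd6 hΔ0), padicValRat.mul hd6 hΔ0, padicValRat.pow, padicValRat.pow, huv, hdv]
    ring
  refine ⟨haddv, ⟨?_, ?_, ?_⟩, hj⟩
  · -- not potentially multiplicative: `ord₃ j(Wd) = ord₃ j(W) ≥ 0`
    unfold PotMult; rw [hj]; exact hG.1
  · -- tame: `f₃(Wd) = f₃(W) = 2`
    unfold CondExpTwo; rw [hf]; exact hG.2.1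
  · -- `e(Wd) = e(W) ∣ 2`
    rw [semistabilityIndex_dvd_iff Wd 3, ← twelve_dvd_padicValRat_Δ_iff Wd 3, hΔ,
      twelve_dvd_padicValRat_Δ_iff W 3, ← semistabilityIndex_dvd_iff W 3]
    exact hG.2.2

/-- **The `χ₋₃`-twist commutes with a Heegner twist, up to `ℚ`-isomorphism.** For `Wd = Cd • W^{(d)}`,
`V = Cv • W^{(−3)}` and `Vd = Cw • Wd^{(−3)}`: `Vd` is a `ℚ`-model of `V^{(d)}` — twisting commutes with changes
of variables (`quadraticTwist_smul`) and is multiplicative (`quadraticTwist_quadraticTwist`). [folklore] -/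
theorem exists_smul_twist_of_minusThree_twists (W : WeierstrassCurve ℚ) (d : ℚ)
    (Wd V Vd : WeierstrassCurve ℚ) (Cd Cv Cw : VariableChange ℚ)
    (hWd : Cd • W.quadraticTwist d = Wd) (hV : Cv • W.quadraticTwist (-3) = V)
    (hVd : Cw • Wd.quadraticTwist (-3) = Vd) :
    ∃ C : VariableChange ℚ, C • V.quadraticTwist d = Vd := by
  -- both sides are `ℚ`-isomorphic to `W^{(−3d)}`
  have e₁ : Wd.quadraticTwist (-3) =
      (⟨Cd.u, (-3) * Cd.r, 0, 0⟩ : VariableChange ℚ) • W.quadraticTwist (d * (-3)) := by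
    rw [← hWd, WeierstrassCurve.quadraticTwist_smul, quadraticTwist_quadraticTwist]
  have e₂ : V.quadraticTwist d =
      (⟨Cv.u, d * Cv.r, 0, 0⟩ : VariableChange ℚ) • W.quadraticTwist ((-3) * d) := by
    rw [← hV, WeierstrassCurve.quadraticTwist_smul, quadraticTwist_quadraticTwist]
  have e₃ : W.quadraticTwist ((-3) * d) =
      (⟨Cv.u, d * Cv.r, 0, 0⟩ : VariableChange ℚ)⁻¹ • V.quadraticTwist d := by
    rw [e₂, inv_smul_smul]
  refine ⟨Cw * ⟨Cd.u, (-3) * Cd.r, 0, 0⟩ * (⟨Cv.u, d * Cv.r, 0, 0⟩ : VariableChange ℚ)⁻¹, ?_⟩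
  rw [← hVd, e₁, mul_comm d (-3), e₃, mul_smul, mul_smul]

/-- **The W-ALL leaf Gss2 at `3` is stable under Heegner twisting.** For `W/ℚ` globally minimal, NON-CM,
additive of census cell `(G) ∧ ss` at `3` (`Addv W 3`, `SubGss W 3`), an imaginary quadratic `K` of ODD
discriminant satisfying the Heegner hypothesis for `N_E`, and any globally minimal model `Wd = Cd • E^{(d_K)}` of
the twist: `Wd` is non-CM (`j` is a twist invariant), additive of cell `(G) ∧ ss` at `3`, with `j(Wd) = j(E)`.
The `(G)` half is `subGord_twist_of_heegner`; the supersingular half goes through the census dictionary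
`O5.subGss_three_iff_subGord_and_goodSS_twist`: the minimal `χ₋₃`-twist `Vd` of `Wd` is a `ℚ`-model of `V^{(d_K)}`
for the minimal `χ₋₃`-twist `V` of `W` (good supersingular at `3`), hence good at `3` (`d_K ∈ ℚ₃^{×2}`) with
`a₃(Vd) = a₃(V)` (`3` splits in `K`; Knapp Prop. 12.10). [cite: Delbourgo1998, §1.5 (G)]
[cite: Knapp1993, Prop. 12.10] [cite: SilvermanATAEC1994, IV.9.4 (PDF pp. 344–346)] -/
theorem leaf_twist_of_heegner (W : WeierstrassCurve ℚ) [W.IsElliptic] [W.IsGloballyMinimal]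
    (hCM : ¬ W.HasCM) (hadd : Addv W 3) (hsub : SubGss W 3)
    (K : Type) [Field K] [NumberField K] (hK : IsImaginaryQuadratic K)
    (hHN : SatisfiesHeegnerHypothesis (W.conductorNorm ℤ) K) (hodd : Odd (NumberField.discr K))
    (Wd : WeierstrassCurve ℚ) [Wd.IsElliptic] [Wd.IsGloballyMinimal] (Cd : VariableChange ℚ)
    (hWd : Cd • W.quadraticTwist (NumberField.discr K : ℚ) = Wd) :
    ¬ Wd.HasCM ∧ Addv Wd 3 ∧ SubGss Wd 3 ∧ Wd.j = W.j := by
  have hp : (3 : ℕ).Prime := Fact.out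
  have hD0 : (NumberField.discr K : ℚ) ≠ 0 := by exact_mod_cast NumberField.discr_ne_zero K
  have hpN : 3 ∣ W.conductorNorm ℤ :=
    (W.dvd_conductorNorm_iff_not_hasGoodReductionAtPrime 3).mpr (not_good_of_addv W 3 hadd)
  have hsq' : IsSquare (algebraMap ℚ ℚ_[3] (NumberField.discr K : ℚ)) :=
    X11b.isSquare_discr_padic_of_heegner K hK hHN 3 hpN
  have hsq : IsSquare (((NumberField.discr K : ℚ) : ℚ) : ℚ_[3]) := by simpa using hsq'
  have hH3 : SatisfiesHeegnerHypothesis 3 K := SatisfiesHeegnerHypothesis.of_dvd hpN hHN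
  have hCMd : ¬ Wd.HasCM := not_hasCM_of_smul_quadraticTwist_eq hD0 hWd hCM
  obtain ⟨haddv, hGd, hj⟩ := subGord_twist_of_heegner W hadd hsub.1 K hK hHN hodd Wd Cd hWd
  -- the minimal `χ₋₃`-twists `V` of `W` (good supersingular at `3`) and `Vd` of `Wd`
  haveI hE3 : (W.quadraticTwist (-3)).IsElliptic := W.isElliptic_quadraticTwist (by norm_num)
  obtain ⟨Cv, hCv⟩ := hasGlobalMinimalModel_rat_holds (W.quadraticTwist (-3))
  haveI : (Cv • W.quadraticTwist (-3)).IsGloballyMinimal := hCv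
  have hssV : GoodSS (Cv • W.quadraticTwist (-3)) 3 :=
    ((O5.subGss_three_iff_subGord_and_goodSS_twist W hadd (Cv • W.quadraticTwist (-3)) Cv rfl).mp hsub).2
  haveI hEd3 : (Wd.quadraticTwist (-3)).IsElliptic := Wd.isElliptic_quadraticTwist (by norm_num)
  obtain ⟨Cw, hCw⟩ := hasGlobalMinimalModel_rat_holds (Wd.quadraticTwist (-3))
  haveI : (Cw • Wd.quadraticTwist (-3)).IsGloballyMinimal := hCw
  -- `Vd` is a `ℚ`-model of `V^{(d_K)}`
  obtain ⟨C, hC⟩ := exists_smul_twist_of_minusThree_twists W (NumberField.discr K : ℚ) Wd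
    (Cv • W.quadraticTwist (-3)) (Cw • Wd.quadraticTwist (-3)) Cd Cv Cw hWd rfl rfl
  -- good at `3` (a `3`-adic-square twist) with the same `a₃` (`3` split in `K`)
  have hgoodVd : (Cw • Wd.quadraticTwist (-3)).HasGoodReductionAtPrime 3 :=
    (AdditivePotMult.good_iff_of_twist (W := Cv • W.quadraticTwist (-3)) hD0 hsq
      (Cw • Wd.quadraticTwist (-3)) hC).mpr hssV.1
  have haVd : (Cw • Wd.quadraticTwist (-3)).frobeniusTrace 3 = (Cv • W.quadraticTwist (-3)).frobeniusTrace 3 :=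
    CastellaGrossiLeeSkinner2022.frobeniusTrace_eq_of_split_twist (W := Cv • W.quadraticTwist (-3)) (p := 3)
      (by norm_num) hssV.1 K hK hodd hH3 (Cw • Wd.quadraticTwist (-3)) ⟨C⁻¹, by rw [← hC, inv_smul_smul]⟩
  have hssVd : GoodSS (Cw • Wd.quadraticTwist (-3)) 3 := ⟨hgoodVd, by rw [haVd]; exact hssV.2⟩
  have hsubd : SubGss Wd 3 :=
    (O5.subGss_three_iff_subGord_and_goodSS_twist Wd haddv (Cw • Wd.quadraticTwist (-3)) Cw rfl).mpr
      ⟨hGd, hssVd⟩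
  exact ⟨hCMd, haddv, hsubd, hj⟩

/-! ### Inside the route: X2 at a rank-ONE pair = the split-field socket at one datum (leaf hypotheses discharged) -/

/-- **X2 at a rank-ONE pair INSIDE the route = the Kolyvagin-side socket at ONE split Heegner datum — with the
twist's leaf membership PROVED.** p607794's `jointUpperBoundAt_rankOne_of_socket_inside_route` took `¬ HasCM Wd`,
`Addv Wd 3`, `SubGss Wd 3` for the globally minimal twist `Wd ≅ W^{(d_{K′})}` as hypotheses and `d_{K′} < −4` as a
binder; `leaf_twist_of_heegner` discharges the first three from the crux's own binders on `W` (`¬ HasCM W`,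
`Addv W 3`, `SubGss W 3`), and `d_{K′} < −4` follows from `d_{K′}` odd with `3 ∣ N_E` split. So: the binders
`hP hT hSR hR` of `closes`, X1 `hL`, the printed facts `hGZ hKo hmod hGZ73`, and for the rank-one member `W` ONE
Heegner datum over an imaginary quadratic `K′` with odd discriminant, the Heegner hypothesis for `N_E`,
`L(W^{(d_{K′})},1) ≠ 0` and the socket `IndexUpperBoundLeAt W 3 K′ P (v₃ c)` give `JointUpperBoundAt W V 3`, X2's
conclusion at `(W, V, d)`. CONDITIONAL on the route's open items X1 and the residual (hypotheses).
[cite: GrossZagier1986, Thm. I.(6.3) and (7.3)] [cite: JetchevSkinnerWan2017, §7.4.1] [cite: Miller2011LMS, Def. 1.1] -/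
theorem jointUpperBoundAt_rankOne_inside_route_of_socket
    (hGZ : ∀ (N : ℕ) [NeZero N] (W : WeierstrassCurve ℚ) (K : Type) [Field K] [NumberField K],
      gross_zagier N W K)
    (hKo : ∀ (N : ℕ) [NeZero N] (W : WeierstrassCurve ℚ) (K : Type) [Field K] [NumberField K],
      kolyvagin N W K)
    (hmod : hasEntireLFunction_rat) (hGZ73 : GrossZagier1986_thm_I_7_3)
    (hP : PublishedInputGZK) (hT : PublishedInputTwists) (hSR : RamifiedTwistSupplyOfPub)
    (hR : GoodSupersingularAtThree) (hL : RamifiedPairLowerBound)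
    (W : WeierstrassCurve ℚ) [W.IsElliptic] [W.IsGloballyMinimal]
    (V : WeierstrassCurve ℚ) [V.IsElliptic] [V.IsGloballyMinimal]
    (hCM : ¬ W.HasCM) (hadd : Addv W 3) (hsub : SubGss W 3) (hCMV : ¬ V.HasCM) (hss : GoodSS V 3)
    (hsum : W.analyticRank + V.analyticRank = 1) (hr : W.analyticRank = 1)
    (N : ℕ) [NeZero N] (K : Type) [Field K] [NumberField K]
    (Dt : ModularParametrizationData W N) (H : HeegnerDatum N (NumberField.discr K)) (ι : K →+* ℂ)
    (P : (W.baseChange K).toAffine.Point) (Wd : WeierstrassCurve ℚ) [Wd.IsElliptic] [Wd.IsGloballyMinimal]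
    (hN : W.conductorNorm ℤ = N) (hK : IsImaginaryQuadratic K) (hodd : Odd (NumberField.discr K))
    (hHH : SatisfiesHeegnerHypothesis N K)
    (hLd : (W.quadraticTwist (NumberField.discr K : ℚ)).entireLFunction 1 ≠ 0)
    (hPt : WeierstrassCurve.Affine.Point.map ι.toRatAlgHom P = heegnerPointComplex Dt H)
    (hC : ∃ C : WeierstrassCurve.VariableChange ℚ, C • W.quadraticTwist (NumberField.discr K : ℚ) = Wd)
    (hI : Upper.IndexUpperBoundLeAt W 3 K P (padicValNat 3 Dt.c.natAbs)) :
    Upper.JointUpperBoundAt W V 3 := by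
  obtain ⟨Cd, hCd⟩ := hC
  have hHN : SatisfiesHeegnerHypothesis (W.conductorNorm ℤ) K := by rw [hN]; exact hHH
  obtain ⟨hCMd, haddd, hsubd, -⟩ := leaf_twist_of_heegner W hCM hadd hsub K hK hHN hodd Wd Cd hCd
  -- `d_K < -4`: `3 ∣ N_E` splits (`d_K ≠ -3`), `d_K` odd (`d_K ≠ -4`), `d_K < 0`
  have h3N : 3 ∣ W.conductorNorm ℤ :=
    (W.dvd_conductorNorm_iff_not_hasGoodReductionAtPrime 3).mpr (not_good_of_addv W 3 hadd)
  have h3 : NumberField.discr K ≠ -3 := by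
    intro h
    exact (X11b.Three.not_dvd_discr_and_not_dvd_torsionOrder_of_heegner hK hHN (by decide) h3N).1
      (h ▸ ⟨-1, by norm_num⟩)
  have hd4 : NumberField.discr K < -4 := by
    haveI : IsTotallyComplex K := hK.2
    have hneg : NumberField.discr K < 0 := WeierstrassCurve.discr_neg_of_finrank_eq_two K hK.1
    have hmod4 := Quadratic.discr_emod_four (K := K) hK.1
    rcases hodd with ⟨k, hk⟩
    omega
  exact jointUpperBoundAt_rankOne_of_socket_inside_route hGZ hKo hmod hGZ73 hP hT hSR hR hL W V hadd hCMV hss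
    hsum hr N K Dt H ι P Wd hN hK hodd hd4 hHH hLd hPt ⟨Cd, hCd⟩ hCMd haddd hsubd hI

end Summit.BirchSwinnertonDyer.BirchSwinnertonDyer.Theorems.RamifiedPairUpperBound

end
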